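import Literature.NumberTheory.CubicFields.PureCubicLexMinSemantics
import Literature.NumberTheory.CubicFields.PureCubicLexMinGamma
import Literature.NumberTheory.CubicFields.PureCubicLexMinNumerics
import Literature.NumberTheory.CubicFields.PureCubicLexMinTransform
import Literature.NumberTheory.CubicFields.PureCubicLexMinScales
import HarnessLib

/-!
# The program `lexE` finds the cylinder minimum at its true scale

Topic `NumberTheory/CubicFields`, sub-namespace `PureCubicLexMin.Correctness`. The completeness half
of the correctness of the program `lexE` of `PureCubicLexMinProgram.lean`: let `c = (den, [h11, …, h33])`
be a lattice code with positive diagonal whose member set (`PureCubicCodes.Mem`) is a fractional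
ideal `I` of the pure cubic field `K = ℚ(θ)`, `θ³ = ab²`, and let `γ ∈ I` be least (for the real
conjugate `σ₁`) in the open unit cylinder `{σ₁ > 0, ‖σ₂‖ < 1}`, with coordinate row `cγ`
(`den γ = cγ H · (1, θ, θ₂)`). If the dyadic scale `X = 2ˢ` brackets `σ₁ γ` (`X ≤ σ₁ γ < 2X`) and
`|s| ≤ 3L + 8`, where `a, b, den, |hᵢⱼ| < 2ᴸ`, then the coordinate row `cγ H` of `γ` is one of the
candidate rows `perScale c (16L + 64) s` enumerated by the program at that scale
(`coords_mem_perScale`).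

The proof assembles the landed ingredients: the accuracy of the rounded embedding matrix
(`bt_approx`), the co-norm of the exact one (`embMatrix_conorm`), the precision budget
(`precision_ineq`), the short-vector facts of the scaled lattice (`half_le_norm_vecMul`,
`norm_vecMul_coords_le_two`), the exactness of the recovered unimodular transformation
(`uEntry_eval_eq`, through `exists_box_coords` below), the LLL machine (`SimApproxLLL.lllOut_spec`)
and the rank-`3` coordinate box (`shortVectorBox_fin_three`). The two rank-`3` lattice inputs (the
enumeration box of an LLL-reduced basis and the sup-norm perturbation bounds) are hypotheses `hC1`,
`hC2`, exactly as in `ShortVectorBoxFinThree.lean`.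

## References

* J. Buchmann, *On the computation of units and class numbers by a generalization of Lagrange's
  algorithm*, J. Number Theory 26 (1987), §3. [folklore]
* H. Cohen, *A Course in Computational Algebraic Number Theory*, GTM 138 (1993), §2.7.3, §6.5.
  [Cohen1993]
-/

noncomputable section

namespace Literature.NumberTheory.CubicFields

namespace PureCubicLexMin

namespace Correctness

open Matrix Literature.Computability.Complexity Literature.Computability.Complexity.RegProg
  Literature.Computability.Complexity.LMat Literature.Computability.Complexity.CodeFP
  Literature.Algebra.EuclideanLattices Literature.Algebra.EuclideanLattices.GapCodes PureCubicCodes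
open scoped NumberField ComplexConjugate nonZeroDivisors

/-! ### The coordinate box through the program's transformation matrix -/

/-- **The program's matrix `U` is the LLL transformation**: for a flat list `bt` of nine integers
with nonsingular matrix `B̃` and LLL output `L = U B̃`, the register expression `uEntry i j`
evaluates on `bt ++ lll9 bt` to `Uᵢⱼ`. [cite: Cohen1993, §2.7.3] -/
theorem uProg_eq (bt : List ℤ) (hlen : bt.length = 9) (U : Matrix (Fin 3) (Fin 3) ℤ)
    (hdet : (toMat 3 3 (rowsOfFlat 3 bt)).det ≠ 0)
    (hU : ((SimApproxLLL.lllOut ⟨3, toMat 3 3 (rowsOfFlat 3 bt)⟩).basis : Matrix (Fin 3) (Fin 3) ℤ) =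
      U * toMat 3 3 (rowsOfFlat 3 bt))
    (i j : Fin 3) :
    Ex.eval 0 (bt ++ lll9 bt) (uEntry i j) = U i j := by
  set Bt : Matrix (Fin 3) (Fin 3) ℤ := toMat 3 3 (rowsOfFlat 3 bt) with hBt
  set Lm : Matrix (Fin 3) (Fin 3) ℤ := (SimApproxLLL.lllOut ⟨3, Bt⟩).basis with hLm
  have h2 : lll9 bt = [Lm 0 0, Lm 0 1, Lm 0 2, Lm 1 0, Lm 1 1, Lm 1 2, Lm 2 0, Lm 2 1, Lm 2 2] :=
    lll9_eq bt Lm (lllOut_three Bt)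
  have h1 : bt = [Bt 0 0, Bt 0 1, Bt 0 2, Bt 1 0, Bt 1 1, Bt 1 2, Bt 2 0, Bt 2 1, Bt 2 2] :=
    eq_flat_toMat bt hlen
  have e : bt ++ lll9 bt = [Bt 0 0, Bt 0 1, Bt 0 2, Bt 1 0, Bt 1 1, Bt 1 2, Bt 2 0, Bt 2 1, Bt 2 2] ++
      [Lm 0 0, Lm 0 1, Lm 0 2, Lm 1 0, Lm 1 1, Lm 1 2, Lm 2 0, Lm 2 1, Lm 2 2] := by
    rw [h2]
    exact congrArg (· ++ _) h1
  rw [e]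
  exact uEntry_eval_eq Bt Lm U hdet hU i j

/-- **The coordinate box, at list level.** Given a real basis matrix `B` with co-norm `μ`, all
nonzero integer rows `≥ 1/2` through `B`, a row `cγ` with `‖cγ B‖ ≤ 2`, and a flat list `bt` of nine
integers approximating `P · B` entrywise within `P δ`, `24 δ ≤ μ`: there are box coefficients
`|cᵢ| ≤ 40` with `(c₀, c₁, c₂) U = cγ` for the program's matrix `U` (`uEntry` on `bt ++ lll9 bt`) —
the coordinates of `cγ` in the LLL-reduced basis of the rounded lattice. [cite: Cohen1993, §2.7.3] -/
theorem exists_box_coords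
    (hC1 : ∀ (b : Fin 3 → EuclideanSpace ℝ (Fin 3)), LinearIndependent ℝ b → IsLLLReduced (3 / 4) b →
      ∀ (m ρ : ℝ), 0 < m → (∀ c : Fin 3 → ℤ, c ≠ 0 → m ≤ ‖∑ i, (c i : ℝ) • b i‖) →
        ∀ c : Fin 3 → ℤ, ‖∑ i, (c i : ℝ) • b i‖ ≤ ρ → ∀ i, |(c i : ℝ)| ≤ 4 * ρ / m + 2)
    (hC2 : ∀ (B B' : Matrix (Fin 3) (Fin 3) ℝ) (δ μ : ℝ), 0 ≤ δ → 0 < μ →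
      (∀ i j, |B i j - B' i j| ≤ δ) → (∀ v : Fin 3 → ℝ, μ * ‖v‖ ≤ ‖Matrix.vecMul v B‖) → 3 * δ < μ →
      ∀ c : Fin 3 → ℤ,
        ‖Matrix.vecMul (fun i => (c i : ℝ)) B'‖ ≤ ‖Matrix.vecMul (fun i => (c i : ℝ)) B‖ * (1 + 3 * δ / μ) ∧
        ‖Matrix.vecMul (fun i => (c i : ℝ)) B‖ * (1 - 3 * δ / μ) ≤ ‖Matrix.vecMul (fun i => (c i : ℝ)) B'‖)
    (B : Matrix (Fin 3) (Fin 3) ℝ) (bt : List ℤ) (hlen : bt.length = 9) {P δ μ : ℝ} (hP : 0 < P)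
    (hδ : 0 ≤ δ) (hμ : 0 < μ) (h24 : 24 * δ ≤ μ)
    (happrox : ∀ i j : Fin 3, |B i j - ((bt.getD ((i : ℕ) * 3 + j) 0 : ℤ) : ℝ) / P| ≤ δ)
    (hco : ∀ v : Fin 3 → ℝ, μ * ‖v‖ ≤ ‖v ᵥ* B‖)
    (hshort : ∀ c : Fin 3 → ℤ, c ≠ 0 → 1 / 2 ≤ ‖(fun i => (c i : ℝ)) ᵥ* B‖)
    (cγ : Fin 3 → ℤ) (hγ : ‖(fun i => (cγ i : ℝ)) ᵥ* B‖ ≤ 2) :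
    ∃ c0 c1 c2 : ℤ, |c0| ≤ 40 ∧ |c1| ≤ 40 ∧ |c2| ≤ 40 ∧
      c0 * Ex.eval 0 (bt ++ lll9 bt) (uEntry 0 0) + c1 * Ex.eval 0 (bt ++ lll9 bt) (uEntry 1 0) +
        c2 * Ex.eval 0 (bt ++ lll9 bt) (uEntry 2 0) = cγ 0 ∧
      c0 * Ex.eval 0 (bt ++ lll9 bt) (uEntry 0 1) + c1 * Ex.eval 0 (bt ++ lll9 bt) (uEntry 1 1) +
        c2 * Ex.eval 0 (bt ++ lll9 bt) (uEntry 2 1) = cγ 1 ∧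
      c0 * Ex.eval 0 (bt ++ lll9 bt) (uEntry 0 2) + c1 * Ex.eval 0 (bt ++ lll9 bt) (uEntry 1 2) +
        c2 * Ex.eval 0 (bt ++ lll9 bt) (uEntry 2 2) = cγ 2 := by
  set Bt : Matrix (Fin 3) (Fin 3) ℤ := toMat 3 3 (rowsOfFlat 3 bt) with hBt
  have happrox' : ∀ i j, |B i j - (Bt i j : ℝ) / P| ≤ δ := fun i j => by
    rw [hBt, toMat_rowsOfFlat]; exact happrox i j
  have hdet : Bt.det ≠ 0 := det_ne_zero_of_approx hC2 B Bt hδ hμ h24 happrox' hco hshort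
  have hns : (⟨3, Bt⟩ : LatticeInstance).IsNonsingular := hdet
  obtain ⟨hlat, hred⟩ := SimApproxLLL.lllOut_spec hns
  set Lm : Matrix (Fin 3) (Fin 3) ℤ := (SimApproxLLL.lllOut ⟨3, Bt⟩).basis with hLm
  have hlat' : (⟨3, Lm⟩ : LatticeInstance).lattice = (⟨3, Bt⟩ : LatticeInstance).lattice := hlat
  have hred' : IsLLLReduced (3 / 4) (⟨3, Lm⟩ : LatticeInstance).vec := hred
  obtain ⟨U, V, hU, hV⟩ := exists_transform_of_lattice_eq Bt Lm hlat'
  obtain ⟨-, -, hcoord, hbox⟩ := shortVectorBox_fin_three hC1 hC2 B Bt Lm U V hP hδ hμ h24 happrox' hco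
    hshort cγ hγ hU hV hred'
  have hUprog : ∀ i j : Fin 3, Ex.eval 0 (bt ++ lll9 bt) (uEntry i j) = U i j := fun i j =>
    uProg_eq bt hlen U hdet hU i j
  have hb : ∀ i, |(cγ ᵥ* V) i| ≤ 40 := fun i => by
    have h := hbox i
    rw [← Int.cast_abs] at h
    exact_mod_cast h
  have hc : ∀ j, (cγ ᵥ* V) 0 * U 0 j + (cγ ᵥ* V) 1 * U 1 j + (cγ ᵥ* V) 2 * U 2 j = cγ j := fun j => by
    simpa only [Matrix.vecMul, dotProduct, Fin.sum_univ_three] using congr_fun hcoord j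
  refine ⟨(cγ ᵥ* V) 0, (cγ ᵥ* V) 1, (cγ ᵥ* V) 2, hb 0, hb 1, hb 2, ?_, ?_, ?_⟩
  · have e0 : Ex.eval 0 (bt ++ lll9 bt) (uEntry 0 0) = U 0 0 := hUprog 0 0
    have e1 : Ex.eval 0 (bt ++ lll9 bt) (uEntry 1 0) = U 1 0 := hUprog 1 0
    have e2 : Ex.eval 0 (bt ++ lll9 bt) (uEntry 2 0) = U 2 0 := hUprog 2 0
    rw [e0, e1, e2]; exact hc 0
  · have e0 : Ex.eval 0 (bt ++ lll9 bt) (uEntry 0 1) = U 0 1 := hUprog 0 1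
    have e1 : Ex.eval 0 (bt ++ lll9 bt) (uEntry 1 1) = U 1 1 := hUprog 1 1
    have e2 : Ex.eval 0 (bt ++ lll9 bt) (uEntry 2 1) = U 2 1 := hUprog 2 1
    rw [e0, e1, e2]; exact hc 1
  · have e0 : Ex.eval 0 (bt ++ lll9 bt) (uEntry 0 2) = U 0 2 := hUprog 0 2
    have e1 : Ex.eval 0 (bt ++ lll9 bt) (uEntry 1 2) = U 1 2 := hUprog 1 2
    have e2 : Ex.eval 0 (bt ++ lll9 bt) (uEntry 2 2) = U 2 2 := hUprog 2 2
    rw [e0, e1, e2]; exact hc 2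

/-! ### The coordinate row of the minimum is a candidate at the true scale -/

section Found

variable {K : Type*} [Field K] [NumberField K] {a b : ℕ} {θ : K} (σ₁ : K →+* ℝ) (σ₂ : K →+* ℂ)
  (hdeg : Module.finrank ℚ K = 3) (hab : Squarefree (a * b)) (hab1 : a * b ≠ 1)
  (hθ : θ ^ 3 = ((a * b ^ 2 : ℕ) : K)) (hσ₂ : ∃ z : K, conj (σ₂ z) ≠ σ₂ z)
  {den : ℕ} (hden : 1 ≤ den) {h11 h12 h13 h22 h23 h33 : ℤ} (p11 : 0 < h11) (p22 : 0 < h22) (p33 : 0 < h33)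
  {I : FractionalIdeal (𝓞 K)⁰ K}
  (hI : ∀ φ : K, Mem θ b (den, [h11, h12, h13, h22, h23, h33]) φ ↔ φ ∈ I)
include hdeg hab hab1 hθ hσ₂ hden p11 p22 p33 hI

/-- **Completeness at the true scale.** With the notation of the module docstring: if `γ` is least in
the unit cylinder of `I`, `den γ = cγ H (1, θ, θ₂)`, `2ˢ ≤ σ₁ γ < 2ˢ⁺¹`, `a, b, den, |hᵢⱼ| < 2ᴸ` and
`|s| ≤ 3L + 8`, then the row `cγ H` is a candidate of `perScale c (16L + 64) s`.
[cite: Cohen1993, §6.5] -/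
theorem coords_mem_perScale
    (hC1 : ∀ (b : Fin 3 → EuclideanSpace ℝ (Fin 3)), LinearIndependent ℝ b → IsLLLReduced (3 / 4) b →
      ∀ (m ρ : ℝ), 0 < m → (∀ c : Fin 3 → ℤ, c ≠ 0 → m ≤ ‖∑ i, (c i : ℝ) • b i‖) →
        ∀ c : Fin 3 → ℤ, ‖∑ i, (c i : ℝ) • b i‖ ≤ ρ → ∀ i, |(c i : ℝ)| ≤ 4 * ρ / m + 2)
    (hC2 : ∀ (B B' : Matrix (Fin 3) (Fin 3) ℝ) (δ μ : ℝ), 0 ≤ δ → 0 < μ →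
      (∀ i j, |B i j - B' i j| ≤ δ) → (∀ v : Fin 3 → ℝ, μ * ‖v‖ ≤ ‖Matrix.vecMul v B‖) → 3 * δ < μ →
      ∀ c : Fin 3 → ℤ,
        ‖Matrix.vecMul (fun i => (c i : ℝ)) B'‖ ≤ ‖Matrix.vecMul (fun i => (c i : ℝ)) B‖ * (1 + 3 * δ / μ) ∧
        ‖Matrix.vecMul (fun i => (c i : ℝ)) B‖ * (1 - 3 * δ / μ) ≤ ‖Matrix.vecMul (fun i => (c i : ℝ)) B'‖)
    {γ : K} (hleast : ∀ φ : K, φ ∈ I → 0 < σ₁ φ → ‖σ₂ φ‖ < 1 → σ₁ γ ≤ σ₁ φ)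
    (hpos : 0 < σ₁ γ) (h1 : ‖σ₂ γ‖ < 1) {cγ : Fin 3 → ℤ}
    (hcγ : (den : K) * γ = lin θ b (cγ 0 * h11, cγ 0 * h12 + cγ 1 * h22, cγ 0 * h13 + cγ 1 * h23 + cγ 2 * h33))
    {L : ℕ} (haL : a < 2 ^ L) (hbL : b < 2 ^ L) (hdL : den < 2 ^ L)
    (hhL : ∀ x ∈ [h11, h12, h13, h22, h23, h33], x.natAbs < 2 ^ L)
    {s : ℤ} (hs : s.natAbs ≤ 3 * L + 8) (hXγ : (2 : ℝ) ^ s ≤ σ₁ γ) (h2X : σ₁ γ < 2 * (2 : ℝ) ^ s) :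
    [cγ 0 * h11, cγ 0 * h12 + cγ 1 * h22, cγ 0 * h13 + cγ 1 * h23 + cγ 2 * h33] ∈
      perScale ((a, b), (den, [h11, h12, h13, h22, h23, h33])) (16 * L + 64) s := by
  obtain ⟨ha0, hb0⟩ := Literature.NumberTheory.NumberFields.PureCubic.ne_zero_of_squarefree_mul hab
  have ha1 : 1 ≤ a := Nat.one_le_iff_ne_zero.2 ha0
  have hb1 : 1 ≤ b := Nat.one_le_iff_ne_zero.2 hb0
  have hab2 : 2 ≤ a * b := by
    have : a * b ≠ 0 := mul_ne_zero ha0 hb0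
    omega
  have hden0 : den ≠ 0 := by omega
  -- the height of the code
  set h : ℕ := max h11.natAbs (max h12.natAbs (max h13.natAbs (max h22.natAbs (max h23.natAbs h33.natAbs))))
    with hh
  have hh1 : 1 ≤ h := le_max_of_le_left (by omega)
  have hhL' : h < 2 ^ L := by
    have e11 := hhL h11 (by simp)
    have e12 := hhL h12 (by simp)
    have e13 := hhL h13 (by simp)
    have e22 := hhL h22 (by simp)
    have e23 := hhL h23 (by simp)
    have e33 := hhL h33 (by simp)
    simp only [hh, max_lt_iff]
    exact ⟨e11, e12, e13, e22, e23, e33⟩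
  have cast_le : ∀ x : ℤ, x.natAbs ≤ h → |(x : ℝ)| ≤ (h : ℝ) := fun x hx => by
    rw [← Int.cast_abs, Int.abs_eq_natAbs]
    exact_mod_cast hx
  have b11 : |(h11 : ℝ)| ≤ h := cast_le h11 (by simp [hh])
  have b12 : |(h12 : ℝ)| ≤ h := cast_le h12 (by simp [hh])
  have b13 : |(h13 : ℝ)| ≤ h := cast_le h13 (by simp [hh])
  have b22 : |(h22 : ℝ)| ≤ h := cast_le h22 (by simp [hh])
  have b23 : |(h23 : ℝ)| ≤ h := cast_le h23 (by simp [hh])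
  have b33 : |(h33 : ℝ)| ≤ h := cast_le h33 (by simp [hh])
  have hhR : (1 : ℝ) ≤ h := by exact_mod_cast hh1
  -- the scale and the budget
  set N : ℕ := 16 * L + 64 with hN
  have hX0 : (0 : ℝ) < (2 : ℝ) ^ s := zpow_pos (by norm_num) s
  have hsN : s.natAbs ≤ N := by omega
  have hP : (0 : ℝ) < 2 ^ N := by positivity
  -- the exact matrix and its rounding
  set B : Matrix (Fin 3) (Fin 3) ℝ := embMatrix (t1 a b) (t2 a b) ((2 : ℝ) ^ s) den [h11, h12, h13, h22, h23, h33]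
    with hB
  set δ : ℝ := 6 * 2 ^ s.natAbs * (h : ℝ) * ((a : ℝ) * b) / 2 ^ N with hδ
  have hδ0 : 0 ≤ δ := by positivity
  have happrox : ∀ i j : Fin 3, |B i j -
      (((btExprs.map (Ex.eval N (regs0 ((a, b), (den, [h11, h12, h13, h22, h23, h33])) N s))).getD
        ((i : ℕ) * 3 + j) 0 : ℤ) : ℝ) / 2 ^ N| ≤ δ := by
    intro i j
    have h0 := bt_approx ha1 hb1 hab2 (Nat.pos_of_ne_zero hden0) h11 h12 h13 h22 h23 h33 hhR b12 b13 b22 b23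
      b33 N s hsN i j
    have e : B i j - (((btExprs.map (Ex.eval N (regs0 ((a, b), (den, [h11, h12, h13, h22, h23, h33])) N s))).getD
        ((i : ℕ) * 3 + j) 0 : ℤ) : ℝ) / 2 ^ N =
        -(((((btExprs.map (Ex.eval N (regs0 ((a, b), (den, [h11, h12, h13, h22, h23, h33])) N s))).getD
          ((i : ℕ) * 3 + j) 0 : ℤ) : ℝ) - 2 ^ N * B i j) / 2 ^ N) := by
      field_simp
      ring
    rw [e, abs_neg, abs_div, abs_of_pos hP, hδ]
    exact div_le_div_of_nonneg_right h0 hP.le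
  -- the co-norm of the exact matrix
  set μ : ℝ := min ((2 : ℝ) ^ s)⁻¹ 1 / (18 * ((a : ℝ) * b) ^ 2 * (h : ℝ) ^ 2 * den) with hμ
  have hμ0 : 0 < μ := by
    have : 0 < min ((2 : ℝ) ^ s)⁻¹ 1 := lt_min (inv_pos.2 hX0) one_pos
    positivity
  have hco : ∀ v : Fin 3 → ℝ, μ * ‖v‖ ≤ ‖v ᵥ* B‖ := fun v =>
    embMatrix_conorm ha1 hb1 hden0 hX0 [h11, h12, h13, h22, h23, h33] (h := (h : ℝ))
      (fun i hi => by
        interval_cases i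
        · simpa using b11
        · simpa using b12
        · simpa using b13
        · simpa using b22
        · simpa using b23
        · simpa using b33)
      (by simp; omega) (by simp; omega) (by simp; omega) v
  -- the precision budget
  have h24 : 24 * δ ≤ μ := precision_ineq haL hbL hdL hhL' ha1 hb1 hden hh1 s hs
  -- short vectors and the coordinate row of `γ`
  have hshort : ∀ c : Fin 3 → ℤ, c ≠ 0 → 1 / 2 ≤ ‖(fun i => (c i : ℝ)) ᵥ* B‖ := fun c hc =>
    half_le_norm_vecMul σ₁ σ₂ hdeg hab hab1 hθ hσ₂ hden0 hI p11.ne' p22.ne' p33.ne' hleast hX0 hXγ hc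
  have hγ2 : ‖(fun i => (cγ i : ℝ)) ᵥ* B‖ ≤ 2 :=
    norm_vecMul_coords_le_two σ₁ σ₂ hdeg hab hab1 hθ hσ₂ hden0 hcγ hpos h1 hX0 h2X
  -- the box
  obtain ⟨c0, c1, c2, hb0', hb1', hb2', e0, e1, e2⟩ := exists_box_coords hC1 hC2 B
    (btExprs.map (Ex.eval N (regs0 ((a, b), (den, [h11, h12, h13, h22, h23, h33])) N s)))
    (length_btExprs_map _) hP hδ0 hμ0 h24 happrox hco hshort cγ hγ2
  have hm := mem_perScale_iff a b den h11 h12 h13 h22 h23 h33 N s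
    [cγ 0 * h11, cγ 0 * h12 + cγ 1 * h22, cγ 0 * h13 + cγ 1 * h23 + cγ 2 * h33]
  dsimp only at hm
  rw [hm]
  refine ⟨c0, c1, c2, hb0', hb1', hb2', ?_⟩
  rw [e0, e1, e2]

end Found

end Correctness

end PureCubicLexMin

end Literature.NumberTheory.CubicFields

end
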